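import Literature.Analysis.FluidPDE.BackwardHeatTestFunction
import Literature.Analysis.FluidPDE.BackwardHeatRegularity
import Literature.Analysis.UnboundedOperators.HeatKernelStrongContinuityProofs
import HarnessLib

/-!
# Proof of Seregin 2014, (A.2.18): the `L∞–L²` estimate for the backward heat inequality

Analysis/FluidPDE proofs file (theorems only). It **discharges the named fact
`Literature.Analysis.FluidPDE.Carleman.seregin_backwardHeat_sup_le_L2`**
(`FluidPDE/BackwardHeatRegularity`; Seregin, *Lecture notes on regularity theory for the
Navier–Stokes equations* (2014), App. A.2, (A.2.18), p. 210, and (A.3.15), p. 213):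

  for every `c₁` there is `c₉ = c₉(c₁, n) > 0` such that for every `x₀ ∈ ℝⁿ` and every `v` of
  class `C²` on a neighbourhood of `[1/2, 1] × B̄(x₀, 1)` with `|∂ₜv + Δv| ≤ c₁(|∇v| + |v|)` there,
  `|v(x₀, 1/2)|² ≤ c₉ ∫_{]1/2,1[×B(x₀,1)} |v|²`.

Seregin quotes this "from the regularity theory for linear parabolic equations"
[Ladyženskaja–Solonnikov–Ural′ceva 1968] without proof. For the heat operator with a bounded
first-order perturbation acting on `C²` functions the classical duality proof is short, and it
is the one formalised here (LSU 1968, Ch. III §8; Lieberman 1996, Ch. VI §6, local maximum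
principle; Evans 2010, §2.3.1 for the heat kernel):

1. `w = |v|²` is a weak subsolution, `∫ (∂ₜG - ΔG - C₀G) |v|² ≤ 0` for test functions `G ≥ 0`
   supported in `U`, `C₀ = 2|c₁| + c₁²/2` (`Carleman.integral_heatOp_mul_norm_sq_nonpos`,
   `FluidPDE/BackwardHeatSubsolution`).
2. Test with the localised **forward** Gaussian `G = ρ_δ θ e^{C₀t} φ(x₀ - x) Γ(t - 1/2 + ε, x₀ - x)`
   of `FluidPDE/BackwardHeatTestFunction` (`Carleman.heatTest`; here `ε = δ`): by the heat
   equation for `Γ`, `∂ₜG - ΔG - C₀G = P + Q` with `P = ρ_δ' e^{C₀t} φΓ ≥ 0` and `|Q| ≤ e^{C₀}K(n)`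
   supported in the open cylinder, whence `∫ P|v|² ≤ ∫ |Q| |v|² ≤ e^{C₀}K ∫_{cyl} |v|²`.
3. `P` concentrates at the pole: on `[1/2, 1/2 + δ] × B(x₀, r)` one has `P ≥ ρ_δ' Γ`,
   `∫_{B(x₀,r)} Γ_s(x₀ - x) dx ≥ 1 - 2^{n/2} e^{-r²/(8s)}` (Gaussian tail,
   `UnboundedOperators.heatKernel_le_mul_heatKernel_two_mul`) and `∫ ρ_δ' = 1`, so by Tonelli
   `∫ P|v|² ≥ (inf_{box} |v|²)(1 - 2^{n/2}e^{-r²/(16δ)})`; continuity of `v` at `(1/2, x₀)` and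
   `δ → 0` give `|v(1/2, x₀)|² ≤ e^{C₀}K ∫_{cyl}|v|²`.

Main statements: `one_sub_le_integral_heatKernel_ball` (Gaussian mass of a ball),
`integral_deriv_rise_mul_heatKernel_ge` (step 3, Tonelli), `norm_sq_le_integral_of_backwardHeat`
(the estimate on any finite-dimensional inner product space `E`, any inner product space `F` of
values), and the discharge `seregin_backwardHeat_sup_le_L2_holds`.

## References

* G. Seregin, *Lecture notes on regularity theory for the Navier–Stokes equations*, World
  Scientific 2014, App. A.2 (A.2.18) p. 210, App. A.3 (A.3.15) p. 213. [Seregin2014]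
* O. A. Ladyženskaja, V. A. Solonnikov, N. N. Ural′ceva, *Linear and quasi-linear equations of
  parabolic type*, Transl. Math. Monogr. 23, AMS 1968, Ch. III §8.
  [LadyzhenskayaSolonnikovUraltseva1968]
* G. M. Lieberman, *Second order parabolic differential equations*, World Scientific 1996,
  Ch. VI §6 (local maximum principle). [Lieberman1996]
* L. C. Evans, *Partial Differential Equations*, 2nd ed., AMS 2010, §2.3.1. [Evans2010]
-/

noncomputable section

open MeasureTheory Filter Topology Set InnerProductSpace Metric Function
open scoped Real NNReal RealInnerProductSpace ContDiff

namespace Literature.Analysis.FluidPDE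

namespace Carleman

open UnboundedOperators Scheffer Literature.Analysis.Calculus

/-! ### Gaussian mass of balls and the Tonelli step -/

section Gauss

variable {E : Type*} [NormedAddCommGroup E] [InnerProductSpace ℝ E] [FiniteDimensional ℝ E]
  [MeasurableSpace E] [BorelSpace E]

/-- **Gaussian mass of a ball**: `∫_{B(x₀, r)} Γ_s(x₀ - x) dx ≥ 1 - 2^{n/2} e^{-r²/(8s)}` for
`s, r > 0` (total mass one, and on `‖x₀ - x‖ ≥ r` the pointwise comparison
`Γ_s ≤ 2^{n/2} e^{-r²/(8s)} Γ_{2s}`). [folklore] -/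
theorem one_sub_le_integral_heatKernel_ball {s r : ℝ} (hs : 0 < s) (hr : 0 < r) (x₀ : E) :
    1 - 2 ^ ((Module.finrank ℝ E : ℝ) / 2) * Real.exp (-r ^ 2 / (8 * s)) ≤
      ∫ x in ball x₀ r, heatKernel s (x₀ - x) := by
  set C := 2 ^ ((Module.finrank ℝ E : ℝ) / 2) * Real.exp (-r ^ 2 / (8 * s)) with hC
  have hC0 : 0 ≤ C := by positivity
  have hint : Integrable fun x : E => heatKernel s (x₀ - x) :=
    (integrable_heatKernel_holds hs).comp_sub_left x₀
  have hint2 : Integrable fun x : E => C * heatKernel (2 * s) (x₀ - x) :=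
    ((integrable_heatKernel_holds (by positivity)).comp_sub_left x₀).const_mul C
  have htot : ∫ x, heatKernel s (x₀ - x) = 1 := by
    rw [integral_sub_left_eq_self (heatKernel s) volume x₀]
    exact integral_heatKernel_eq_one_holds hs
  have htot2 : ∫ x, C * heatKernel (2 * s) (x₀ - x) = C := by
    rw [integral_const_mul, integral_sub_left_eq_self (heatKernel (2 * s)) volume x₀,
      integral_heatKernel_eq_one_holds (by positivity), mul_one]
  have hsplit := integral_add_compl (measurableSet_ball (x := x₀) (ε := r)) hint
  have htail : ∫ x in (ball x₀ r)ᶜ, heatKernel s (x₀ - x) ≤ C := by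
    calc ∫ x in (ball x₀ r)ᶜ, heatKernel s (x₀ - x)
        ≤ ∫ x in (ball x₀ r)ᶜ, C * heatKernel (2 * s) (x₀ - x) := by
          refine setIntegral_mono_on hint.integrableOn hint2.integrableOn
            measurableSet_ball.compl fun x hx => ?_
          have hx' : r ≤ ‖x₀ - x‖ := by
            rw [mem_compl_iff, mem_ball, dist_eq_norm, ← norm_sub_rev, not_lt] at hx
            exact hx
          exact heatKernel_le_mul_heatKernel_two_mul hs hr.le hx'
      _ ≤ ∫ x, C * heatKernel (2 * s) (x₀ - x) :=
          setIntegral_le_integral hint2 (Eventually.of_forall fun x =>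
            mul_nonneg hC0 (heatKernel_pos (by positivity) _).le)
      _ = C := htot2
  linarith

omit [FiniteDimensional ℝ E] [MeasurableSpace E] [BorelSpace E] in
/-- Joint continuity of `(t, x) ↦ Γ_{t-1/2+ε}(x₀ - x)` on `t > 1/2 - ε`. [folklore] -/
theorem continuousOn_heatKernel_comp {ε : ℝ} (x₀ : E) :
    ContinuousOn (fun z : ℝ × E => heatKernel (z.1 - 1 / 2 + ε) (x₀ - z.2))
      {z : ℝ × E | 1 / 2 - ε < z.1} := by
  have hmap : Continuous fun z : ℝ × E => ((z.1 - 1 / 2 + ε, x₀ - z.2) : ℝ × E) := by fun_prop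
  have hmaps : MapsTo (fun z : ℝ × E => ((z.1 - 1 / 2 + ε, x₀ - z.2) : ℝ × E))
      {z : ℝ × E | 1 / 2 - ε < z.1} (Ioi (0 : ℝ) ×ˢ univ) := fun z hz => by
    have hz' : 1 / 2 - ε < z.1 := hz
    refine ⟨?_, mem_univ _⟩
    show (0 : ℝ) < z.1 - 1 / 2 + ε
    linarith
  have h := ContinuousOn.comp (g := fun p : ℝ × E => heatKernel p.1 p.2)
    (f := fun z : ℝ × E => ((z.1 - 1 / 2 + ε, x₀ - z.2) : ℝ × E))
    (contDiffOn_uncurry_heatKernel (m := 0)).continuousOn hmap.continuousOn hmaps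
  exact h

/-- **The Tonelli step.** For `ε, δ, r > 0`,
`∫_{[1/2,1/2+δ]×B(x₀,r)} ρ_δ'(t) Γ_{t-1/2+ε}(x₀ - x) d(t,x) ≥ 1 - 2^{n/2} e^{-r²/(8(δ+ε))}`:
integrate first in `x` (Gaussian mass of the ball, the variance `t - 1/2 + ε` being at most
`δ + ε`), then `∫_{1/2}^{1/2+δ} ρ_δ' = 1`. [folklore] -/
theorem integral_deriv_rise_mul_heatKernel_ge {ε δ r : ℝ} (hε : 0 < ε) (hδ : 0 < δ) (hr : 0 < r)
    (x₀ : E) :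
    1 - 2 ^ ((Module.finrank ℝ E : ℝ) / 2) * Real.exp (-r ^ 2 / (8 * (δ + ε))) ≤
      ∫ z in Icc (1 / 2 : ℝ) (1 / 2 + δ) ×ˢ ball x₀ r,
        deriv (rise δ) z.1 * heatKernel (z.1 - 1 / 2 + ε) (x₀ - z.2) := by
  set τ := 2 ^ ((Module.finrank ℝ E : ℝ) / 2) * Real.exp (-r ^ 2 / (8 * (δ + ε))) with hτ
  set f : ℝ × E → ℝ := fun z => deriv (rise δ) z.1 * heatKernel (z.1 - 1 / 2 + ε) (x₀ - z.2)
    with hf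
  -- integrability on the product set
  have hd : Continuous fun z : ℝ × E => deriv (rise δ) z.1 :=
    ((contDiff_rise (m := 1) δ).continuous_deriv le_rfl).comp continuous_fst
  have hcont : ContinuousOn f (Icc (1 / 2 : ℝ) (1 / 2 + δ) ×ˢ closedBall x₀ r) := by
    refine hd.continuousOn.mul ((continuousOn_heatKernel_comp x₀).mono ?_)
    rintro z ⟨⟨hz1, -⟩, -⟩
    show 1 / 2 - ε < z.1
    linarith
  have hint : IntegrableOn f (Icc (1 / 2 : ℝ) (1 / 2 + δ) ×ˢ ball x₀ r) :=
    (hcont.integrableOn_compact (isCompact_Icc.prod (isCompact_closedBall _ _))).mono_set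
      (prod_mono Subset.rfl ball_subset_closedBall)
  have hint' : Integrable f ((volume.restrict (Icc (1 / 2 : ℝ) (1 / 2 + δ))).prod
      (volume.restrict (ball x₀ r))) := by
    rw [Measure.prod_restrict, ← Measure.volume_eq_prod]
    exact hint
  rw [Measure.volume_eq_prod, setIntegral_prod f hint]
  -- the inner integral
  have hinner : ∀ t ∈ Icc (1 / 2 : ℝ) (1 / 2 + δ),
      deriv (rise δ) t * (1 - τ) ≤ ∫ x in ball x₀ r, f (t, x) := by
    intro t ht
    have hσ : 0 < t - 1 / 2 + ε := by linarith [ht.1]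
    have hσ' : t - 1 / 2 + ε ≤ δ + ε := by linarith [ht.2]
    simp only [hf]
    rw [integral_const_mul]
    refine mul_le_mul_of_nonneg_left ?_ (deriv_rise_nonneg hδ t)
    have hexp : Real.exp (-r ^ 2 / (8 * (t - 1 / 2 + ε))) ≤ Real.exp (-r ^ 2 / (8 * (δ + ε))) := by
      refine Real.exp_le_exp.2 ?_
      rw [neg_div, neg_div, neg_le_neg_iff]
      exact div_le_div_of_nonneg_left (sq_nonneg r) (by positivity) (by linarith)
    have hτ' : 2 ^ ((Module.finrank ℝ E : ℝ) / 2) * Real.exp (-r ^ 2 / (8 * (t - 1 / 2 + ε))) ≤ τ :=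
      mul_le_mul_of_nonneg_left hexp (by positivity)
    calc 1 - τ ≤ 1 - 2 ^ ((Module.finrank ℝ E : ℝ) / 2) * Real.exp (-r ^ 2 / (8 * (t - 1 / 2 + ε))) := by
          linarith
      _ ≤ ∫ x in ball x₀ r, heatKernel (t - 1 / 2 + ε) (x₀ - x) :=
          one_sub_le_integral_heatKernel_ball hσ hr x₀
  -- integrate in `t`
  have hi1 : IntegrableOn (fun t => deriv (rise δ) t * (1 - τ)) (Icc (1 / 2 : ℝ) (1 / 2 + δ)) :=
    ((((contDiff_rise (m := 1) δ).continuous_deriv le_rfl).mul continuous_const).continuousOn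
      ).integrableOn_compact isCompact_Icc
  have hi2 : IntegrableOn (fun t => ∫ x in ball x₀ r, f (t, x)) (Icc (1 / 2 : ℝ) (1 / 2 + δ)) :=
    hint'.integral_prod_left
  have hmono := setIntegral_mono_on hi1 hi2 measurableSet_Icc hinner
  have hleft : ∫ t in Icc (1 / 2 : ℝ) (1 / 2 + δ), deriv (rise δ) t * (1 - τ) = 1 - τ := by
    rw [integral_mul_const, integral_Icc_eq_integral_Ioc,
      ← intervalIntegral.integral_of_le (by linarith), integral_deriv_rise hδ, one_mul]
  linarith

end Gauss

/-! ### The estimate -/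

section Estimate

variable {E : Type*} [NormedAddCommGroup E] [InnerProductSpace ℝ E] [FiniteDimensional ℝ E]
  [MeasurableSpace E] [BorelSpace E]
variable {F : Type*} [NormedAddCommGroup F] [InnerProductSpace ℝ F]

omit [InnerProductSpace ℝ F] in
/-- Products `P |v|²` with `P` continuous, vanishing off a compact `K ⊆ U`, and `v` continuous on
the open `U`, are integrable on `ℝ × E`. [folklore] -/
theorem integrable_mul_norm_sq_of_support {U K : Set (ℝ × E)} (hU : IsOpen U) (hK : IsCompact K)
    (hKU : K ⊆ U) {P : ℝ × E → ℝ} (hP : Continuous P) (hPK : ∀ z, P z ≠ 0 → z ∈ K)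
    {v : ℝ × E → F} (hv : ContinuousOn v U) : Integrable fun z => P z * ‖v z‖ ^ 2 := by
  have h0 : ∀ z, z ∉ K → P z * ‖v z‖ ^ 2 = 0 := fun z hz => by
    have : P z = 0 := not_not.1 fun h => hz (hPK z h)
    simp [this]
  have hc : Continuous fun z => P z * ‖v z‖ ^ 2 :=
    continuous_of_continuousOn_of_eq_zero hU hK.isClosed hKU
      (hP.continuousOn.mul (hv.norm.pow 2)) h0
  exact hc.integrable_of_hasCompactSupport (HasCompactSupport.intro hK h0)

/-- A small variance with the prescribed Gaussian tail: for `r, γ > 0` there is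
`0 < δ ≤ min(r, 1/4)` with `2^{n/2} e^{-r²/(16δ)} ≤ γ`. [folklore] -/
theorem exists_delta_tail_le (n : ℝ) {r γ : ℝ} (hr : 0 < r) (hγ : 0 < γ) :
    ∃ δ : ℝ, 0 < δ ∧ δ ≤ r ∧ δ ≤ 1 / 4 ∧
      2 ^ (n / 2) * Real.exp (-r ^ 2 / (8 * (δ + δ))) ≤ γ := by
  have h1 : Tendsto (fun δ : ℝ => (r ^ 2 / 16) * δ⁻¹) (𝓝[>] 0) atTop :=
    tendsto_inv_nhdsGT_zero.const_mul_atTop (by positivity)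
  have h2 : Tendsto (fun δ : ℝ => Real.exp (-((r ^ 2 / 16) * δ⁻¹))) (𝓝[>] 0) (𝓝 0) :=
    Real.tendsto_exp_atBot.comp (tendsto_neg_atTop_atBot.comp h1)
  have h3 : Tendsto (fun δ : ℝ => 2 ^ (n / 2) * Real.exp (-((r ^ 2 / 16) * δ⁻¹))) (𝓝[>] 0)
      (𝓝 0) := by
    simpa using h2.const_mul (2 ^ (n / 2))
  have h4 : Tendsto (fun δ : ℝ => 2 ^ (n / 2) * Real.exp (-r ^ 2 / (8 * (δ + δ)))) (𝓝[>] 0)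
      (𝓝 0) := by
    refine h3.congr' ?_
    filter_upwards [self_mem_nhdsWithin] with δ hδ
    have hδ0 : (δ : ℝ) ≠ 0 := ne_of_gt hδ
    congr 2
    field_simp
    ring
  have hev1 : ∀ᶠ δ in 𝓝[>] (0 : ℝ), 2 ^ (n / 2) * Real.exp (-r ^ 2 / (8 * (δ + δ))) ≤ γ :=
    h4.eventually (Iic_mem_nhds hγ)
  have hev2 : ∀ᶠ δ in 𝓝[>] (0 : ℝ), δ < min r (1 / 4) :=
    mem_nhdsWithin_of_mem_nhds (Iio_mem_nhds (lt_min hr (by norm_num)))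
  have hev3 : ∀ᶠ δ in 𝓝[>] (0 : ℝ), 0 < δ := eventually_mem_nhdsWithin
  obtain ⟨δ, hδ0, hδ1, hδ2⟩ := (hev3.and (hev2.and hev1)).exists
  exact ⟨δ, hδ0, (hδ1.le.trans (min_le_left _ _)), (hδ1.le.trans (min_le_right _ _)), hδ2⟩

/-- **The `L∞–L²` estimate for the backward heat inequality** on a finite-dimensional inner
product space `E` (values in any real inner product space `F`): for every `c₁` there is
`c₉ = c₉(c₁, dim E) > 0` such that for every `x₀`, every open `U ⊇ [1/2, 1] × B̄(x₀, 1)` and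
every `v ∈ C²(U; F)` with `|∂ₜv + Δₓv| ≤ c₁(|∇ₓv| + |v|)` on `U`,
`|v(1/2, x₀)|² ≤ c₉ ∫_{]1/2,1[×B(x₀,1)} |v|²` (duality proof, see the file header).
[cite: Seregin2014, App. A.2 (A.2.18)] -/
theorem norm_sq_le_integral_of_backwardHeat (c₁ : ℝ) :
    ∃ c₉ : ℝ, 0 < c₉ ∧ ∀ (x₀ : E) (v : ℝ × E → F) (U : Set (ℝ × E)), IsOpen U →
      Icc (1 / 2 : ℝ) 1 ×ˢ closedBall x₀ 1 ⊆ U → ContDiffOn ℝ 2 v U →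
      (∀ z ∈ U, ‖dt v z + lap v z‖ ≤ c₁ * (Real.sqrt (gradSq v z) + ‖v z‖)) →
      ‖v ((1 / 2 : ℝ), x₀)‖ ^ 2 ≤ c₉ * ∫ z in Ioo (1 / 2 : ℝ) 1 ×ˢ ball x₀ 1, ‖v z‖ ^ 2 := by
  obtain ⟨K, hK0, hK⟩ := exists_abs_heatTestRem_le (E := E)
  set c := |c₁| with hc
  set C₀ : ℝ := 2 * c + c ^ 2 / 2 with hC₀
  have hC₀0 : 0 ≤ C₀ := by positivity
  set M := Real.exp C₀ * K with hM
  have hM0 : 0 ≤ M := by positivity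
  refine ⟨M + 1, by positivity, fun x₀ v U hU hsub hv hineq => ?_⟩
  set I := ∫ z in Ioo (1 / 2 : ℝ) 1 ×ˢ ball x₀ 1, ‖v z‖ ^ 2 with hI
  set w₀ := ‖v ((1 / 2 : ℝ), x₀)‖ ^ 2 with hw₀
  have hcont : ContinuousOn v U := hv.continuousOn
  have hineq' : ∀ z ∈ U, ‖dt v z + lap v z‖ ≤ c * (Real.sqrt (gradSq v z) + ‖v z‖) :=
    fun z hz => (hineq z hz).trans (mul_le_mul_of_nonneg_right (le_abs_self c₁)
      (add_nonneg (Real.sqrt_nonneg _) (norm_nonneg _)))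
  have hcyl : Ioo (1 / 2 : ℝ) 1 ×ˢ ball x₀ 1 ⊆ Icc (1 / 2 : ℝ) 1 ×ˢ closedBall x₀ 1 :=
    prod_mono Ioo_subset_Icc_self ball_subset_closedBall
  have hKc : IsCompact (Icc (1 / 2 : ℝ) 1 ×ˢ closedBall x₀ 1) :=
    isCompact_Icc.prod (isCompact_closedBall _ _)
  have hmeas : MeasurableSet (Ioo (1 / 2 : ℝ) 1 ×ˢ ball x₀ 1) :=
    measurableSet_Ioo.prod measurableSet_ball
  have hI0 : 0 ≤ I := setIntegral_nonneg hmeas fun z _ => sq_nonneg _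
  have hvI : IntegrableOn (fun z => ‖v z‖ ^ 2) (Ioo (1 / 2 : ℝ) 1 ×ˢ ball x₀ 1) :=
    (((hcont.mono hsub).norm.pow 2).integrableOn_compact hKc).mono_set hcyl
  -- the estimate up to `γ`
  have key : ∀ γ : ℝ, 0 < γ → γ < 1 → (w₀ - γ) * (1 - γ) ≤ M * I := by
    intro γ hγ0 hγ1
    rcases le_or_gt w₀ γ with hwγ | hwγ
    · nlinarith
    -- continuity of `|v|²` at the pole
    have hz₀U : ((1 / 2 : ℝ), x₀) ∈ U :=
      hsub ⟨⟨le_rfl, by norm_num⟩, mem_closedBall_self zero_le_one⟩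
    have hca : ContinuousAt (fun z => ‖v z‖ ^ 2) ((1 / 2 : ℝ), x₀) :=
      ((hcont.continuousAt (hU.mem_nhds hz₀U)).norm.pow 2)
    have hev : ∀ᶠ z in 𝓝 ((1 / 2 : ℝ), x₀), w₀ - γ < ‖v z‖ ^ 2 :=
      hca.eventually (lt_mem_nhds (by linarith))
    obtain ⟨ρ, hρ, hball⟩ := Metric.eventually_nhds_iff_ball.1 hev
    set r := min (ρ / 2) (1 / 2) with hr
    have hr0 : 0 < r := by positivity
    have hrρ : r < ρ := (min_le_left _ _).trans_lt (by linarith)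
    have hr2 : r ≤ 1 / 2 := min_le_right _ _
    have hlow : ∀ z : ℝ × E, z.1 ∈ Icc (1 / 2 : ℝ) (1 / 2 + r) → z.2 ∈ ball x₀ r →
        w₀ - γ < ‖v z‖ ^ 2 := by
      intro z ht hx
      apply hball
      rw [mem_ball, Prod.dist_eq, max_lt_iff]
      refine ⟨?_, (mem_ball.1 hx).trans hrρ⟩
      rw [Real.dist_eq, abs_lt]
      constructor <;> linarith [ht.1, ht.2]
    -- the variance
    obtain ⟨δ, hδ0, hδr, hδ4, hτ⟩ := exists_delta_tail_le (Module.finrank ℝ E : ℝ) hr0 hγ0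
    -- the test function with `ε = δ`
    have hG2 : ContDiff ℝ 2 (heatTest C₀ δ δ x₀) := contDiff_two_heatTest hδ0 hδ0
    have hGc : HasCompactSupport (heatTest C₀ δ δ x₀) := hasCompactSupport_heatTest hδ0
    have hGU : tsupport (heatTest C₀ δ δ x₀) ⊆ U :=
      (tsupport_heatTest_subset hδ0).trans ((prod_mono Subset.rfl
        (closedBall_subset_closedBall (by norm_num))).trans hsub)
    have hG0 : ∀ z, 0 ≤ heatTest C₀ δ δ x₀ z := heatTest_nonneg hδ0 hδ0
    have hweak := integral_heatOp_mul_norm_sq_nonpos hU hv hineq' hG2 hGc hGU hG0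
    -- `∂ₜG - ΔG - C₀G = P + Q`
    set P := heatTestPos C₀ δ δ x₀ with hP
    set Q := heatTestRem C₀ δ δ x₀ with hQ
    have hPQ : ∀ z, (dt (heatTest C₀ δ δ x₀) z - lap (heatTest C₀ δ δ x₀) z -
        (2 * c + c ^ 2 / 2) * heatTest C₀ δ δ x₀ z) * ‖v z‖ ^ 2 =
          P z * ‖v z‖ ^ 2 + Q z * ‖v z‖ ^ 2 := fun z => by
      rw [dt_sub_lap_heatTest hδ0 hδ0 hδ4 z]
      ring
    have hKb := fun z => hK C₀ δ δ x₀ hC₀0 hδ0 hδ0 hδ4 z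
    -- integrability
    have hPi : Integrable fun z => P z * ‖v z‖ ^ 2 := by
      refine integrable_mul_norm_sq_of_support hU hKc hsub (continuous_heatTestPos hδ0 hδ0)
        (fun z hz => ?_) hcont
      obtain ⟨⟨h1, h2⟩, h3⟩ := heatTestPos_ne_zero_imp hδ0 hz
      refine ⟨⟨h1.le, by linarith⟩, ?_⟩
      rw [mem_closedBall, dist_eq_norm, ← norm_sub_rev]
      linarith
    have hQi : Integrable fun z => Q z * ‖v z‖ ^ 2 :=
      integrable_mul_norm_sq_of_support hU hKc hsub (continuous_heatTestRem hδ0 hδ0)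
        (fun z hz => hcyl ((hKb z).2 hz)) hcont
    have hQai : Integrable fun z => |Q z| * ‖v z‖ ^ 2 := by
      have : (fun z => |Q z| * ‖v z‖ ^ 2) = fun z => |Q z * ‖v z‖ ^ 2| := by
        funext z
        rw [abs_mul, abs_of_nonneg (sq_nonneg ‖v z‖)]
      rw [this]
      exact hQi.abs
    -- split the weak inequality
    have hsum : (∫ z, P z * ‖v z‖ ^ 2) + ∫ z, Q z * ‖v z‖ ^ 2 ≤ 0 := by
      rw [← integral_add hPi hQi]
      calc ∫ z, P z * ‖v z‖ ^ 2 + Q z * ‖v z‖ ^ 2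
          = ∫ z, (dt (heatTest C₀ δ δ x₀) z - lap (heatTest C₀ δ δ x₀) z -
              (2 * c + c ^ 2 / 2) * heatTest C₀ δ δ x₀ z) * ‖v z‖ ^ 2 :=
            integral_congr_ae (Eventually.of_forall fun z => (hPQ z).symm)
        _ ≤ 0 := hweak
    -- the bounded part
    have hQb : -(∫ z, Q z * ‖v z‖ ^ 2) ≤ M * I := by
      rw [← integral_neg]
      have h1 : ∫ z, -(Q z * ‖v z‖ ^ 2) ≤ ∫ z, |Q z| * ‖v z‖ ^ 2 :=
        integral_mono hQi.neg hQai fun z => by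
          have := neg_abs_le (Q z)
          nlinarith [sq_nonneg ‖v z‖]
      have h2 : ∫ z, |Q z| * ‖v z‖ ^ 2 = ∫ z in Ioo (1 / 2 : ℝ) 1 ×ˢ ball x₀ 1, |Q z| * ‖v z‖ ^ 2 := by
        refine (setIntegral_eq_integral_of_forall_compl_eq_zero fun z hz => ?_).symm
        have : Q z = 0 := not_not.1 fun h => hz ((hKb z).2 h)
        simp [this]
      have h3 : ∫ z in Ioo (1 / 2 : ℝ) 1 ×ˢ ball x₀ 1, |Q z| * ‖v z‖ ^ 2 ≤
          ∫ z in Ioo (1 / 2 : ℝ) 1 ×ˢ ball x₀ 1, M * ‖v z‖ ^ 2 :=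
        setIntegral_mono_on hQai.integrableOn (hvI.const_mul M) hmeas fun z _ =>
          mul_le_mul_of_nonneg_right ((hKb z).1) (sq_nonneg _)
      have h4 : ∫ z in Ioo (1 / 2 : ℝ) 1 ×ˢ ball x₀ 1, M * ‖v z‖ ^ 2 = M * I :=
        integral_const_mul _ _
      linarith
    -- the positive part near the pole
    have hPb : (w₀ - γ) * (1 - γ) ≤ ∫ z, P z * ‖v z‖ ^ 2 := by
      set S := Icc (1 / 2 : ℝ) (1 / 2 + δ) ×ˢ ball x₀ r with hS
      have hSm : MeasurableSet S := measurableSet_Icc.prod measurableSet_ball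
      have h1 : ∫ z in S, P z * ‖v z‖ ^ 2 ≤ ∫ z, P z * ‖v z‖ ^ 2 :=
        setIntegral_le_integral hPi (Eventually.of_forall fun z =>
          mul_nonneg (heatTestPos_nonneg hδ0 hδ0 z) (sq_nonneg _))
      set g : ℝ × E → ℝ := fun z => deriv (rise δ) z.1 * heatKernel (z.1 - 1 / 2 + δ) (x₀ - z.2)
        with hg
      have hgc : ContinuousOn g (Icc (1 / 2 : ℝ) (1 / 2 + δ) ×ˢ closedBall x₀ r) := by
        refine ((((contDiff_rise (m := 1) δ).continuous_deriv le_rfl).comp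
          continuous_fst).continuousOn).mul ((continuousOn_heatKernel_comp x₀).mono ?_)
        rintro z ⟨⟨hz1, -⟩, -⟩
        show 1 / 2 - δ < z.1
        linarith
      have hgi : IntegrableOn g S :=
        (hgc.integrableOn_compact (isCompact_Icc.prod (isCompact_closedBall _ _))).mono_set
          (prod_mono Subset.rfl ball_subset_closedBall)
      have h2 : ∫ z in S, (w₀ - γ) * g z ≤ ∫ z in S, P z * ‖v z‖ ^ 2 := by
        refine setIntegral_mono_on (hgi.const_mul _) hPi.integrableOn hSm fun z hz => ?_
        obtain ⟨ht, hx⟩ := hz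
        have hxn : ‖x₀ - z.2‖ ≤ 1 / 2 := by
          have hx' := mem_ball.1 hx
          rw [dist_eq_norm, ← norm_sub_rev] at hx'
          linarith
        have hgP : g z ≤ P z := by
          have := deriv_rise_mul_heatKernel_le_heatTestPos hC₀0 hδ0 hδ0 ht.1 hxn
          simpa only [hg, hP] using this
        have hvz : w₀ - γ ≤ ‖v z‖ ^ 2 := (hlow z ⟨ht.1, ht.2.trans (by linarith)⟩ hx).le
        calc (w₀ - γ) * g z ≤ (w₀ - γ) * P z := mul_le_mul_of_nonneg_left hgP (by linarith)
          _ ≤ ‖v z‖ ^ 2 * P z := mul_le_mul_of_nonneg_right hvz (heatTestPos_nonneg hδ0 hδ0 z)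
          _ = P z * ‖v z‖ ^ 2 := mul_comm _ _
      have h3 : (w₀ - γ) * (1 - γ) ≤ ∫ z in S, (w₀ - γ) * g z := by
        rw [integral_const_mul]
        refine mul_le_mul_of_nonneg_left ?_ (by linarith)
        calc 1 - γ ≤ 1 - 2 ^ ((Module.finrank ℝ E : ℝ) / 2) * Real.exp (-r ^ 2 / (8 * (δ + δ))) := by
              linarith
          _ ≤ ∫ z in S, g z := integral_deriv_rise_mul_heatKernel_ge hδ0 hδ0 hr0 x₀
      linarith
    linarith
  -- `γ → 0`
  have hfin : w₀ ≤ M * I := by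
    have ht : Tendsto (fun γ : ℝ => (w₀ - γ) * (1 - γ)) (𝓝[>] 0) (𝓝 ((w₀ - 0) * (1 - 0))) :=
      (((continuous_const.sub continuous_id).mul (continuous_const.sub continuous_id)).tendsto
        0).mono_left nhdsWithin_le_nhds
    rw [sub_zero, sub_zero, mul_one] at ht
    refine le_of_tendsto ht ?_
    filter_upwards [Ioo_mem_nhdsGT one_pos] with γ hγ
    exact key γ hγ.1 hγ.2
  nlinarith

end Estimate

/-! ### The discharge -/

/-- **Seregin 2014, (A.2.18) / (A.3.15), proved**: discharge of the named fact
`Carleman.seregin_backwardHeat_sup_le_L2` (the local `L∞–L²` estimate for the backward heat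
inequality, quoted by Seregin from the regularity theory of linear parabolic equations), from
`norm_sq_le_integral_of_backwardHeat` with `E = ℝⁿ`, `F = ℝᵐ`.
[cite: Seregin2014, App. A.2 (A.2.18)] -/
theorem seregin_backwardHeat_sup_le_L2_holds : seregin_backwardHeat_sup_le_L2 := by
  intro n m c₁
  exact norm_sq_le_integral_of_backwardHeat (E := EuclideanSpace ℝ (Fin n))
    (F := EuclideanSpace ℝ (Fin m)) c₁

end Carleman

end Literature.Analysis.FluidPDE
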